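import Literature.NumberTheory.GaloisRepresentations.AdZeroBlochKatoDatum
import Literature.NumberTheory.Automorphic.HeckeAlgebraOfTypeSigma
import HarnessLib

/-!
# Stub ideas for `stub_liftThree` — ideator k2 (HOME: RESHAPE), generation 7

Companion to `STUB-IDEAS-stub_liftThree-2.md` (crux `FreyModularity`, item `stmt-ABC-11340`,
route `ABC/DefiniteXi`).  Generations 1–6 of this seat typed: the regime split and the
`R = T ⇒ stub` frame (g1, `StubIdeas2`), de Smit–Rubin–Schoof / Brochard (g3), the ordinary road
and an `ℕ∞` Σ-induction (g4), Fujiwara freeness patching (g5), and the *minimal-level* Selmer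
count `dim H¹_∅(ad⁰ρ̄) = …` (g6, `StubIdeas2g6`).  What was only ever CITED (g1 `TypeSigmaLiftThree`
docstring, g4 hypotheses `hSel`/`hIh`) is the **Σ-step** — the passage from the minimal
isomorphism `R_∅ ≅ T_∅` to `R_Σ ≅ T_Σ` for `Σ =` the primes of `N_W` — and that is what a Frey
curve actually consumes (it is never minimally ramified at the level-lowering primes).

## The reshape (DDT 1995, §3.3 pp. 97–98 and §3.5 p. 101)

For `q ∈ Σ_ρ̄ ∖ (Σ ∪ {3})` put `c_q = (q - 1)(T_q² - (q + 1)²) ∈ T_Σ`,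
`π(c_q) = (q - 1)(a_q² - (q + 1)²) ≠ 0` (Weil bound).  Then
* (local factor, DDT p. 97) `#H¹(ℚ_q, A)/H¹_ur(ℚ_q, A) = #H⁰(ℚ_q, A(1)) = #O/π(c_q)`,
  `A = ad⁰ρ_f ⊗ K/O` — here: `H2` (kernel on `V/T` = cokernel on `T`) + `H3` (cokernel = `O/det`)
  + `H1` (`det = charpoly(ad⁰ρ(1))(Frob_q)` at `X = 1`, from the tree's
  `FramedGaloisRep.charpoly_adZeroTateTwist`) + `H4` (`≠ 0`);
* (Prop. 3.35, Galois side) `#H¹_Σ'/#H¹_Σ ≤ ∏ #O/π(c_q)` — here `H5`, an instance of the tree's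
  PROVED `SelmerStructure.natCard_quotient_selmerGroup_le_prod` for `sigmaSelmerStructure`;
* (Thm. 3.36 = Ihara, Hecke side) `η_Σ' ⊆ π(∏ c_q) η_Σ` — here the named-fact-size `IharaEtaStep`
  over the tree's `sigmaCongruenceIdeal`;
* hence (3.5.1) `#H¹_∅ = #O/η_∅` ⇒ (3.5.2) `#H¹_Σ ≤ #O/η_Σ` (`SigmaStep`), and (3.5.2) + DDT
  Thm. 2.41 (`Hom(℘_Σ/℘_Σ², K/O) ≅ H¹_Σ`) + the numerical criterion Thm. 3.40 (tree, proved: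
  `numericalCriterion_le_holds`, `bijective_of_length_cotangentModule_le`) give `R_Σ ≅ T_Σ` in ONE
  step — no prime-by-prime induction (g4's `sigma_step_criterion` collapses to `∏ c_q`).
`SigmaSelmerBound` below is, verbatim, the informal crux `SigmaSelmerBoundByCongruenceIdeal` of
route `Langlands/AdjointEulerNumerical` (stmt-Langlands-14534): every brick here serves it too.

Helpers are `theorem … := by sorry` unless a 1–3 line proof closed them; sizes in the docstrings.
Nothing here is registered; the lead / critic picks.
-/

set_option linter.dupNamespace false

noncomputable section

open scoped NumberField MatrixGroups
open Field IsDedekindDomain IsLocalRing Rat.HeightOneSpectrum Polynomial Topology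
open Literature.NumberTheory.GaloisRepresentations Literature.NumberTheory.Automorphic

namespace Summit.ABC.ABC.Cruxes.FreyModularity.StubIdeas2g7

universe u v w

/-! ## H1 — the local factor is a characteristic-polynomial value (XS, proved) -/

section H1

variable {K : Type u} [Field K] (p : ℕ) [Fact p.Prime] {O : Type v} [CommRing O] [Algebra ℤ_[p] O]
  [TopologicalSpace O] [IsTopologicalRing O]

/-- **H1** `charpoly(ad⁰ρ(1))(σ)` at `X = 1` is `(1 - q)((q + 1)² - (tr ρ σ)²)` whenever
`χ_p(σ) = q = det ρ(σ)` (arithmetic Frobenius at `q ∤ p N`, `det ρ = χ_p`): DDT's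
`π(c_q) = (q-1)(a_q² - (q+1)²)` up to sign, read off the tree's `charpoly_adZeroTateTwist`.
[cite: DarmonDiamondTaylor1995, §3.3 p. 97 (definition of `c_p`)] -/
theorem eval_one_charpoly_adZeroTateTwist (ρ : FramedGaloisRep K O 2)
    (hO : Continuous (algebraMap ℤ_[p] O)) (σ : absoluteGaloisGroup K) (q : O)
    (hχ : ((cyclotomicCharacterToUnitsCont K p O hO σ : Oˣ) : O) = q)
    (hdet : ((Matrix.GeneralLinearGroup.det (ρ σ) : Oˣ) : O) = q) :
    (FramedRep.charpoly (ρ.adZeroTateTwist p hO) σ).eval 1 =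
      (1 - q) * ((q + 1) ^ 2 - (FramedRep.trace ρ σ) ^ 2) := by
  have hinv : q * (((Matrix.GeneralLinearGroup.det (ρ σ))⁻¹ : Oˣ) : O) = 1 := by
    rw [← hdet, ← Units.val_mul, mul_inv_cancel, Units.val_one]
  rw [FramedGaloisRep.charpoly_adZeroTateTwist, hχ]
  simp only [eval_mul, eval_sub, eval_add, eval_pow, eval_X, eval_C, one_pow, mul_one]
  linear_combination (-(1 - q) * (FramedRep.trace ρ σ) ^ 2) * hinv

end H1

/-! ## H2 — kernel on `V/T` = cokernel on `T` for a lattice-preserving automorphism (S) -/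

/-- **H2** For an automorphism `f` of `V` with `f(T) ⊆ T`, the kernel of the induced endomorphism
of `V/T` is `f⁻¹(T)/T ≅ T/f(T)`: `#ker(f̄ | V/T) = #(T/f T)`.  Used with `V = ad⁰ρ ⊗ K`,
`T = ad⁰_O ρ(1)`, `f = Frob_q - 1` (invertible over `K` because `det ≠ 0`, H1 + H4), so that
`#H⁰(ℚ_q, A(1)) = #(T/(Frob_q - 1)T)`. [folklore] [cite: DarmonDiamondTaylor1995, §3.3 p. 97] -/
theorem natCard_ker_mapQ_eq_natCard_quotient {O : Type u} [CommRing O] {V : Type v}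
    [AddCommGroup V] [Module O V] (T : Submodule O V) (f : V ≃ₗ[O] V)
    (hf : T ≤ T.comap (f : V →ₗ[O] V)) :
    Nat.card (LinearMap.ker (T.mapQ T (f : V →ₗ[O] V) hf)) =
      Nat.card (↥T ⧸ (T.map (f : V →ₗ[O] V)).comap T.subtype) := by
  sorry

/-! ## H3 — cokernel of a square matrix over a PID has `#(O/det)` elements (M) -/

/-- **H3** Over a principal ideal domain, `#(Oⁿ/A Oⁿ) = #(O/det A)` for `det A ≠ 0` (Smith normal
form `A ~ diag(dᵢ)`, `Oⁿ/A Oⁿ ≅ ⊕ O/dᵢ`, `#O/(∏ dᵢ) = ∏ #O/dᵢ`; both sides `0` when infinite).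
The tree has the `ℤ_[p]` case (`natCard_quotient_range_toLin'_eq_pow_valuation_det`) and the
length form over any one-dimensional Noetherian domain
(`Literature.RingTheory.OrderOfVanishing.length_quotient_range_toLin'_eq_ord_det`, Fulton A.2.6)
plus `Literature.Algebra.Module.natCard_eq_pow_length`; the TW coefficient ring at `p = 3` is
`W(𝔽₉) = ℤ₃[i]` (Frobenius eigenvalues `±i`), so the general DVR/PID case is the one needed.
[cite: Fulton1998, Lemma A.2.6] -/
theorem natCard_quotient_range_mulVecLin_eq {O : Type u} [CommRing O] [IsDomain O]
    [IsPrincipalIdealRing O] {ι : Type v} [Fintype ι] [DecidableEq ι] (A : Matrix ι ι O)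
    (hA : A.det ≠ 0) :
    Nat.card ((ι → O) ⧸ LinearMap.range A.mulVecLin) = Nat.card (O ⧸ Ideal.span {A.det}) := by
  sorry

/-! ## H4 — the level-raising factor never vanishes (XS, proved) -/

/-- **H4** `(q - 1)((q + 1)² - a²) ≠ 0` for `q ≥ 2` and `a² ≤ 4q` (Weil/Hasse bound; apply under a
real embedding of the totally real coefficient field, or with `a = a_q(W) ∈ ℤ` via the tree's
`Literature.NumberTheory.EllipticCurves.hasse_bound`): `(q+1)² - a² ≥ (q-1)² ≥ 1`.  DDT: "which is
non-zero by theorem 1.27(a)". [cite: DarmonDiamondTaylor1995, §3.3 p. 97] -/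
theorem levelRaisingFactor_ne_zero (q : ℕ) (a : ℝ) (hq : 2 ≤ q) (ha : a ^ 2 ≤ 4 * q) :
    ((q : ℝ) - 1) * (((q : ℝ) + 1) ^ 2 - a ^ 2) ≠ 0 := by
  have hq' : (2 : ℝ) ≤ q := by exact_mod_cast hq
  have h1 : ((q : ℝ) - 1) ≠ 0 := by intro h; linarith
  have h2 : 0 < ((q : ℝ) + 1) ^ 2 - a ^ 2 := by nlinarith
  exact mul_ne_zero h1 h2.ne'

/-! ## H5 — DDT Prop. 3.35, Galois side, for the tree's `sigmaSelmerStructure` (S) -/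

section H5

variable {K : Type u} [Field K] [NumberField K] {W : Type u} [AddCommGroup W] [TopologicalSpace W]
  [DiscreteTopology W]

/-- **H5** Enlarging `Σ` to `Σ'` (finite places not above `p`) relaxes the unramified condition to
no condition exactly at `v ∈ Σ' ∖ Σ`, so
`#(H¹_Σ'(K, W)/H¹_Σ(K, W)) ≤ ∏_{v ∈ Σ'∖Σ, v ∤ p} #(H¹(K_v, W)/H¹_ur(K_v, W))` — an instance of the
tree's proved `SelmerStructure.natCard_quotient_selmerGroup_le_prod` (`𝓕 = Σ`-structure,
`𝓖 = Σ'`-structure, equal off `Σ' ∖ Σ`).  With H1–H4 each factor is `#O/π(c_q)`.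
[cite: DarmonDiamondTaylor1995, Prop. 3.35, p. 98] -/
theorem natCard_sigmaSelmerGroup_quotient_le_prod (p : ℕ) (ρ : DiscreteGaloisModule K W)
    (L : ρ.LocalConditionsAbove p) (S S' : Set (HeightOneSpectrum (𝓞 K))) (hSS' : S ⊆ S')
    (T : Finset (HeightOneSpectrum (𝓞 K)))
    (hT : ∀ v, v ∈ T ↔ v ∈ S' ∧ v ∉ S ∧ ((p : ℕ) : 𝓞 K) ∉ v.asIdeal)
    (hfin : ∀ v ∈ T, Finite (galoisCohomology (GaloisRep.toLocal v ρ) 1 ⧸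
      DiscreteGaloisModule.unramifiedSubgroup (GaloisRep.toLocal v ρ) 1)) :
    Nat.card (↥(ρ.sigmaSelmerGroup p S' L) ⧸
        (ρ.sigmaSelmerGroup p S L).addSubgroupOf (ρ.sigmaSelmerGroup p S' L)) ≤
      ∏ v ∈ T, Nat.card (galoisCohomology (GaloisRep.toLocal v ρ) 1 ⧸
        DiscreteGaloisModule.unramifiedSubgroup (GaloisRep.toLocal v ρ) 1) := by
  sorry

end H5

/-! ## H6 — DDT Thm. 3.36 (Ihara) and (3.5.2), typed over the tree's `T_Σ`, `η_Σ`, `H¹_Σ` -/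

section H6

variable (p : ℕ) (k : ℤ) {O : Type} [CommRing O] [TopologicalSpace O]
  (Ō : Type v) [CommRing Ō] [IsLocalRing Ō] [TopologicalSpace Ō] [Algebra O Ō]
  (ρ : FramedGaloisRep ℚ O 2)

/-- **H6a `IharaEtaStep`** (DDT Thm. 3.36, one prime at a time; named-fact size, L): for a good
Frobenius `σ = Frob_q`, `q ∉ Σ ∪ {p}`, `ρ` unramified at `q`,
`η_{Σ ∪ {q}} ⊆ (q - 1)((tr ρ σ)² - (q + 1)²) · η_Σ` — the congruence ideals of the tree's
`heckeAlgebraOfTypeSigma` (`sigmaCongruenceIdeal`, DDT (3.3.1)).  Its proof is Ihara's lemma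
(DDT Thm. 4.24, Lemma 4.28; tree pieces `ihara_periodHomology_mod_eisenstein`,
`IharaLemmaModTwoSymbolForm`). [cite: DarmonDiamondTaylor1995, Thm. 3.36 p. 98 and §4.4 pp. 133–135] -/
def IharaEtaStep (S : Set ℕ) : Prop :=
  ∀ (v : HeightOneSpectrum (𝓞 ℚ)) (𝔓 : Ideal (absIntegers (𝓞 ℚ) ℚ)) (σ : absoluteGaloisGroup ℚ),
    ((primesEquiv v : Nat.Primes) : ℕ) ∉ S → ((primesEquiv v : Nat.Primes) : ℕ) ≠ p →
      ρ.IsUnramifiedAt v → 𝔓 ∈ v.primesAbove → IsArithFrobAt (𝓞 ℚ) σ 𝔓 →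
        sigmaCongruenceIdeal p k Ō ρ (insert ((primesEquiv v : Nat.Primes) : ℕ) S) ≤
          Ideal.span {((((primesEquiv v : Nat.Primes) : ℕ) : O) - 1) *
              ((FramedRep.trace ρ σ) ^ 2 - ((((primesEquiv v : Nat.Primes) : ℕ) : O) + 1) ^ 2)} *
            sigmaCongruenceIdeal p k Ō ρ S

variable {L : Type} [Field L] [Algebra O L] [TopologicalSpace L] [IsTopologicalRing L]

/-- **H6b `SigmaSelmerBound`** = DDT (3.5.2) `#H¹_Σ(ℚ, ad⁰ρ ⊗ L/O) ≤ #(O/η_Σ)`, typed with the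
tree's `adZeroBlochKatoDatum`/`sigmaSelmerStructure`/`HasCardLE` and `sigmaCongruenceIdeal`
(`C` = the chosen condition above `p`: finite/flat or ordinary).  Verbatim the informal crux
`SigmaSelmerBoundByCongruenceIdeal` of `Langlands/AdjointEulerNumerical`.
[cite: DarmonDiamondTaylor1995, (3.5.2) p. 101] -/
def SigmaSelmerBound (hL : IsOpenEmbedding (algebraMap O L)) (S : Set ℕ)
    (C : (ρ.adZeroBlochKatoDatum hL).repW.LocalConditionsAbove p) : Prop :=
  ((ρ.adZeroBlochKatoDatum hL).repW.sigmaSelmerStructure p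
      {v | ((primesEquiv v : Nat.Primes) : ℕ) ∈ S} C).HasCardLE
    (Nat.card (O ⧸ sigmaCongruenceIdeal p k Ō ρ S))

/-- **H6c `SigmaStep`** = DDT "(3.5.1) ⇒ (3.5.2)": if the minimal Selmer group has exactly
`#(O/η_∅)` elements then `#H¹_Σ ≤ #(O/η_Σ)` for every finite `Σ ⊆ Σ_ρ̄ ∖ {p}`.  Assembly:
H5 + (H1–H4 local factors) + H6a, multiplying `#O/(c η) = #O/(c) · #O/η`.
[cite: DarmonDiamondTaylor1995, §3.5 p. 101, (3.5.1)–(3.5.2)] -/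
def SigmaStep (hL : IsOpenEmbedding (algebraMap O L)) (S : Finset ℕ)
    (C : (ρ.adZeroBlochKatoDatum hL).repW.LocalConditionsAbove p) : Prop :=
  (∀ q ∈ S, q ≠ p ∧ ∀ v : HeightOneSpectrum (𝓞 ℚ), ((primesEquiv v : Nat.Primes) : ℕ) = q →
      ρ.IsUnramifiedAt v) →
    ((ρ.adZeroBlochKatoDatum hL).repW.sigmaSelmerStructure p ∅ C).HasCardEq
        (Nat.card (O ⧸ sigmaCongruenceIdeal p k Ō ρ ∅)) →
      SigmaSelmerBound p k Ō ρ hL (↑S) C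

end H6

end Summit.ABC.ABC.Cruxes.FreyModularity.StubIdeas2g7

end
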